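import Summits.KontsevichZagierPeriods.KontsevichZagierPeriods.Theses.LinRedNormalForm

/-!
# KontsevichZagierPeriods / LinRedNormalForm — the assembly `Assembly` (stmt-KontsevichZagierPeriods-3919)

Route `KontsevichZagierPeriods/LinRedNormalForm` (linear reducibility read as a normal form inside the
Kontsevich–Zagier calculus of moves), item stmt-KontsevichZagierPeriods-3919 (`Assembly`, rank 1):

  `DihedralNormalForm → MzvKernelInKZ → ResidualBeyondGenusZero → KontsevichZagierPeriods`.

Informal content.  The three hypotheses give the KERNEL FORM of Conjecture 1,
`Literature.NumberTheory.Transcendental.KZKernelConjecture` (`∀ c, eval c = 0 → c ∈ KZ.relations`),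
which implies the summit (`[r] − [r']` has value `0` when `r.value = r'.value`).  For the kernel form:
let `eval c = 0`.  The declared residual `ResidualBeyondGenusZero` gives `c₀` in the additive closure of
the genus-zero representations with `c − c₀ ∈ KZ.relations`; the normal form `DihedralNormalForm`
(stated generator-wise, extended additively over `AddSubgroup.closure` by
`exists_mem_closure_sub_mem_of_forall`) gives `m` in the additive closure of the MZV word
representations with `c₀ − m ∈ KZ.relations`; soundness of the calculus
(`Literature.NumberTheory.Transcendental.KZ.relations_le_ker_eval_holds`: relations evaluate to `0`)
gives `eval m = eval c₀ = eval c = 0`, so `m ∈ KZ.relations` by the kernel hypothesis `MzvKernelInKZ`,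
and `c = (c − c₀) + (c₀ − m) + m ∈ KZ.relations`.

The three antecedents are the route's cruxes / declared residual (items 3912, 3914, 3917) and are NOT
discharged here: the theorems are implications, nothing more.  (The same term is the route's
deciding theorem `…Theses.LinRedNormalForm.closes`; the proof below is self-contained and factors
through the kernel form, which is the reusable intermediate.)

References: M. Kontsevich, D. Zagier, *Periods* (2001), §1.2 (the three rules; Conjecture 1 and its
kernel form); A. Huber, S. Müller-Stach, *Periods and Nori Motives* (2017), §13.1; F. Brown,
*Multiple zeta values and periods of moduli spaces `𝔐_{0,n}`*, Ann. Sci. ÉNS 42 (2009), Thm 1.1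
(value-level shadow of the normal form).
-/

namespace Summit.KontsevichZagierPeriods.LinRedNormalForm

open Literature.NumberTheory.Transcendental
open Summit.KontsevichZagierPeriods.KontsevichZagierPeriods.Theses.LinRedNormalForm

/-- **Additive extension of a generator-wise normal form.**  In an additive commutative group with a
subgroup `R` of "relations": if every generator `x ∈ S` is congruent modulo `R` to some element of
`AddSubgroup.closure T`, then so is every element of `AddSubgroup.closure S`
(`AddSubgroup.closure_induction`; the witnesses add and negate). [folklore] -/
theorem exists_mem_closure_sub_mem_of_forall {G : Type*} [AddCommGroup G] (R : AddSubgroup G)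
    {S T : Set G} (hS : ∀ x ∈ S, ∃ m ∈ AddSubgroup.closure T, x - m ∈ R) {c : G}
    (hc : c ∈ AddSubgroup.closure S) : ∃ m ∈ AddSubgroup.closure T, c - m ∈ R := by
  induction hc using AddSubgroup.closure_induction with
  | mem x hx => exact hS x hx
  | zero => exact ⟨0, zero_mem _, by simp⟩
  | add x y _ _ ihx ihy =>
    obtain ⟨m₁, hm₁, h₁⟩ := ihx
    obtain ⟨m₂, hm₂, h₂⟩ := ihy
    refine ⟨m₁ + m₂, add_mem hm₁ hm₂, ?_⟩
    have key := add_mem h₁ h₂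
    rwa [show x - m₁ + (y - m₂) = x + y - (m₁ + m₂) by abel] at key
  | neg x _ ih =>
    obtain ⟨m, hm, h⟩ := ih
    refine ⟨-m, neg_mem hm, ?_⟩
    have key := neg_mem h
    rwa [show -(x - m) = -x - -m by abel] at key

/-- **Kernel form from the genus-zero sector data of route LinRedNormalForm.**  The genus-zero normal
form `DihedralNormalForm`, the kernel on MZV word representations `MzvKernelInKZ` and the declared
residual `ResidualBeyondGenusZero` together give `ker eval = relations`
(`Literature.NumberTheory.Transcendental.KZKernelConjecture`): for `eval c = 0`, the residual gives
`c₀ ∈ closure (genus-zero reps)` with `c − c₀ ∈ relations`, the normal form (extended additively)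
gives `m ∈ closure (MZV word reps)` with `c₀ − m ∈ relations`, soundness
`KZ.relations_le_ker_eval_holds` gives `eval m = 0`, the kernel hypothesis gives `m ∈ relations`,
and `c = (c − c₀) + (c₀ − m) + m`. [Kontsevich–Zagier 2001, §1.2] [folklore] -/
theorem kzKernelConjecture_of_normalForm_kernel_residual (hNF : DihedralNormalForm)
    (hKER : MzvKernelInKZ) (hRES : ResidualBeyondGenusZero) : KZKernelConjecture := by
  intro c hc
  -- soundness of the calculus: relations evaluate to zero
  have hsound : ∀ x ∈ KZ.relations, KZ.eval x = 0 := fun x hx =>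
    (AddMonoidHom.mem_ker).1 (KZ.relations_le_ker_eval_holds hx)
  -- the residual: reduce to the genus-zero sector
  obtain ⟨c₀, hc₀, hcc₀⟩ := hRES c hc
  -- the normal form on generators, extended additively over the closure
  obtain ⟨m, hm, hcm⟩ := exists_mem_closure_sub_mem_of_forall KZ.relations
    (fun x hx => by
      obtain ⟨k, s, p, a, b, e, hdom, hint, rfl⟩ := hx
      exact hNF k s p a b e hdom hint) hc₀
  -- the MZV combination `m` has value zero, hence is a relation by the kernel hypothesis
  have h₁ := hsound _ hcc₀
  have h₂ := hsound _ hcm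
  rw [map_sub] at h₁ h₂
  have hm0 : KZ.eval m = 0 := by linarith
  -- add up: c = (c - c₀) + (c₀ - m) + m
  have key := add_mem (add_mem hcc₀ hcm) (hKER m hm hm0)
  rwa [sub_add_sub_cancel, sub_add_cancel] at key

/-- **Assembly of route LinRedNormalForm** (settles stmt-KontsevichZagierPeriods-3919):
`DihedralNormalForm → MzvKernelInKZ → ResidualBeyondGenusZero → KontsevichZagierPeriods`.
Given the genus-zero normal form, the kernel on MZV word representations and the declared residual,
any two rational-shape KZ representations `r`, `r'` with `r.value = r'.value` are KZ-equivalent: the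
three hypotheses give the kernel form `ker eval = relations`
(`kzKernelConjecture_of_normalForm_kernel_residual`), and `eval ([r] − [r']) = r.value − r'.value = 0`
(`KZ.eval_of`), so `[r] − [r'] ∈ KZ.relations`, which is `KZ.Equivalent r r'` by definition; the
rationality hypotheses on the endpoints are not used. [Kontsevich–Zagier 2001, §1.2] [folklore] -/
theorem assembly_proof :
    Summit.KontsevichZagierPeriods.KontsevichZagierPeriods.Theses.LinRedNormalForm.Assembly := by
  unfold Summit.KontsevichZagierPeriods.KontsevichZagierPeriods.Theses.LinRedNormalForm.Assembly
  intro hNF hKER hRES n n' r r' _ _ hv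
  apply kzKernelConjecture_of_normalForm_kernel_residual hNF hKER hRES
  simp [KZ.eval_of, hv]

end Summit.KontsevichZagierPeriods.LinRedNormalForm
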